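import Summits.PneNP.PneNP.Theorems.SmallBlockRothvossBallGridBound
import Literature.Combinatorics.Optimization.SDPFormulationMatchingSlack
import HarnessLib

/-!
# Block psd lifts of the perfect matching polytope: block-diagonal SDP formulations (cell pnp-psdrank, rung F-N2.SOC)

Landing file 6 (pnp-psdrank-eng g4; work file HOME/pnp-psdrank-eng/lean/BlockLift.lean v5). The
formulation-level reading of the block bound, in the tree's audited SDP-formulation vocabulary
(`Literature.Combinatorics.Optimization.SDPFormulation`, Braun et al. Def. 2.2): if an exact SDP formulation of
`PM_n` of any size `d` has all its solution matrices `X^M` block diagonal for a block assignment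
`blk : Fin d → Fin m` with blocks of size `≤ b`, then — by the duality factorization `S(U,M) = tr(A_U X^M)`
(`SDPFormulation.exists_hasPsdFactorization_pmOddCutSlack`), psd-ness of the diagonal blocks of `A_U`, and
extension by zero to size `b` — the odd-cut slack matrix has an `(S^b_+)^m` factorization
(`hasBlockPsdFactorization_of_blockDiagonalSDP`), hence `2^{c·n/(b+1)} ≤ m·n⁹` for `1 ≤ b ≤ n`
(`blockDiagonalSDP_largeBlocks`): a block-diagonal SDP formulation of the perfect matching problem with
polynomially many blocks has a block of dimension `Ω(n/log n)`.
[cite: BraunEtAl2016, Def. 2.2, Lemma 2.3] [cite: GouveiaParriloThomas2013, Thm. 2.4] [cite: Rothvoss2017, Thm. 1]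
WHAT THIS IS NOT: not a bound on general (single-block) SDP formulations of matching (rung F-N2 stays open);
nothing P ≠ NP-relevant; exact formulations only (`ε = 0`).
-/

set_option linter.dupNamespace false -- `Summit.PneNP.PneNP.…`: summit = sub-problem (D-0017)

noncomputable section

open scoped MatrixOrder

open Finset Real Matrix Literature.Barriers.PneNP Literature.Combinatorics.Optimization

namespace Summit.PneNP.PneNP.Theorems.SmallBlockRothvossBallGrid

/-! ### From SDP formulations (Braun et al. Def. 2.2) with block-diagonal structure to block factorizations -/

section Formulation

variable {ι : Type} [DecidableEq ι] {b : ℕ}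

/-- Columns of the identity indexed by an embedding `e : ι ↪ Fin b`: `Eᴴ E = 1`. -/
theorem cols_conjTranspose_mul (e : ι ↪ Fin b) :
    ((1 : Matrix (Fin b) (Fin b) ℝ).submatrix id e)ᴴ * (1 : Matrix (Fin b) (Fin b) ℝ).submatrix id e = 1 := by
  ext j j'
  rw [Matrix.mul_apply]
  simp only [conjTranspose_apply, submatrix_apply, id, star_trivial, Matrix.one_apply]
  by_cases hjj : j = j'
  · subst hjj
    rw [if_pos rfl, Finset.sum_eq_single (e j)]
    · simp
    · intro p _ hp
      rw [if_neg hp]; simp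
    · intro h; exact absurd (Finset.mem_univ _) h
  · rw [if_neg hjj]
    refine Finset.sum_eq_zero fun p _ => ?_
    by_cases h1 : p = e j
    · subst h1
      have h2 : e j ≠ e j' := fun h => hjj (e.injective h)
      rw [if_neg h2]; simp
    · rw [if_neg h1]; simp

variable [Fintype ι]

/-- Extension by zero `X ↦ E X Eᴴ` along `e : ι ↪ Fin b` preserves pairings. -/
theorem trace_extend_mul_extend (e : ι ↪ Fin b) (X Y : Matrix ι ι ℝ) :
    ((1 : Matrix (Fin b) (Fin b) ℝ).submatrix id e * X * ((1 : Matrix (Fin b) (Fin b) ℝ).submatrix id e)ᴴ *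
      ((1 : Matrix (Fin b) (Fin b) ℝ).submatrix id e * Y *
        ((1 : Matrix (Fin b) (Fin b) ℝ).submatrix id e)ᴴ)).trace = (X * Y).trace := by
  set E : Matrix (Fin b) ι ℝ := (1 : Matrix (Fin b) (Fin b) ℝ).submatrix id e with hE
  have hEE : Eᴴ * E = 1 := cols_conjTranspose_mul e
  have h1 : E * X * Eᴴ * (E * Y * Eᴴ) = E * (X * Y) * Eᴴ := by
    calc E * X * Eᴴ * (E * Y * Eᴴ) = E * X * (Eᴴ * E) * Y * Eᴴ := by simp only [Matrix.mul_assoc]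
      _ = E * (X * Y) * Eᴴ := by rw [hEE, Matrix.mul_one]; simp only [Matrix.mul_assoc]
  rw [h1, Matrix.trace_mul_cycle, hEE, Matrix.one_mul]

omit [DecidableEq ι] in
/-- The pairing of two principal submatrices, as a double sum. -/
theorem trace_submatrix_mul_submatrix {d : ℕ} (Z X : Matrix (Fin d) (Fin d) ℝ) (f : ι → Fin d) :
    (Z.submatrix f f * X.submatrix f f).trace = ∑ p : ι, ∑ q : ι, Z (f p) (f q) * X (f q) (f p) := by
  simp only [Matrix.trace, Matrix.diag, Matrix.mul_apply, submatrix_apply]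

end Formulation

/-- **Block-diagonal trace split.** If `X` is block diagonal for the block assignment `blk`
(`X p q = 0` whenever `blk p ≠ blk q`), then `tr(Z X) = Σ_i Σ_{p,q ∈ block i} Z_{pq} X_{qp}`. -/
theorem trace_mul_blockDiagonal_split {d m : ℕ} (blk : Fin d → Fin m) (Z X : Matrix (Fin d) (Fin d) ℝ)
    (hX : ∀ p q, blk p ≠ blk q → X p q = 0) :
    (Z * X).trace = ∑ i : Fin m,
      ∑ p : {p : Fin d // blk p = i}, ∑ q : {p : Fin d // blk p = i}, Z p.1 q.1 * X q.1 p.1 := by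
  have hL : (Z * X).trace = ∑ p : Fin d, ∑ q : Fin d, Z p q * X q p := by
    simp only [Matrix.trace, Matrix.diag, Matrix.mul_apply]
  rw [hL, ← Fintype.sum_fiberwise blk (fun p => ∑ q : Fin d, Z p q * X q p)]
  refine Fintype.sum_congr _ _ fun i => Fintype.sum_congr _ _ fun p => ?_
  -- inner sum: only `q` in the block of `p` contribute
  have h1 : ∑ q : Fin d, Z p.1 q * X q p.1 = ∑ q ∈ univ.filter (fun q : Fin d => blk q = i), Z p.1 q * X q p.1 := by
    refine (Finset.sum_filter_of_ne fun q _ hq => ?_).symm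
    by_contra hne
    apply hq
    rw [hX q p.1 (by rw [p.2]; exact hne), mul_zero]
  rw [h1]
  exact Finset.sum_subtype _ (fun q => by simp) (fun q : Fin d => Z p.1 q * X q p.1)

/-- **SDP formulations with block-diagonal structure give block factorizations.** Let `E` be an (exact) SDP
formulation of `PM_n` of size `d` (Braun et al. Def. 2.2) whose solution matrices `X^M` are all block diagonal
for a block assignment `blk : Fin d → Fin m` with blocks of size `≤ b`. Then the odd-cut slack matrix of
`P_PM(n)` has an `(S^b_+)^m` factorization. (Duality factorization `S(U,M) = tr(A_U X^M)`,
`exists_hasPsdFactorization_pmOddCutSlack`; the diagonal blocks of the psd `A_U` are psd; extend by zero to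
size `b`.) [cite: BraunEtAl2016, Def. 2.2, Lemma 2.3] [cite: GouveiaParriloThomas2013, Thm. 2.4] -/
theorem hasBlockPsdFactorization_of_blockDiagonalSDP {n d m b : ℕ}
    (E : SDPFormulation (pmProblem n 0) d) (blk : Fin d → Fin m)
    (hX : ∀ (M : PMSol n) (p q : Fin d), blk p ≠ blk q → E.X M p q = 0)
    (hsize : ∀ i : Fin m, (univ.filter fun p : Fin d => blk p = i).card ≤ b) :
    HasBlockPsdFactorization n b m := by
  obtain ⟨A, hA, hS⟩ := E.exists_hasPsdFactorization_pmOddCutSlack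
  -- block index types and their embeddings into `Fin b`
  have hcard : ∀ i : Fin m, Fintype.card {p : Fin d // blk p = i} ≤ b := by
    intro i
    rw [Fintype.card_subtype]
    exact hsize i
  let emb : (i : Fin m) → {p : Fin d // blk p = i} ↪ Fin b := fun i =>
    (Fintype.equivFin {p : Fin d // blk p = i}).toEmbedding.trans (Fin.castLEEmb (hcard i))
  refine hasBlockPsdFactorization_iff.2
    ⟨fun M i => (1 : Matrix (Fin b) (Fin b) ℝ).submatrix id (emb i) *
        (E.X M).submatrix Subtype.val Subtype.val * ((1 : Matrix (Fin b) (Fin b) ℝ).submatrix id (emb i))ᴴ,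
     fun U i => (1 : Matrix (Fin b) (Fin b) ℝ).submatrix id (emb i) *
        (A U).submatrix Subtype.val Subtype.val * ((1 : Matrix (Fin b) (Fin b) ℝ).submatrix id (emb i))ᴴ,
     fun M i => ((E.posSemidef_X M).submatrix _).mul_mul_conjTranspose_same _,
     fun U i => ((hA U).submatrix _).mul_mul_conjTranspose_same _, fun U M => ?_⟩
  rw [hS U M, trace_mul_blockDiagonal_split blk (A U) (E.X M) (hX M)]
  refine sum_congr rfl fun i _ => ?_
  rw [trace_extend_mul_extend (emb i), trace_submatrix_mul_submatrix, Finset.sum_comm]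
  exact sum_congr rfl fun q _ => sum_congr rfl fun p _ => mul_comm _ _

/-- **Block-diagonal SDP formulations of the perfect matching problem need a large block.** There are
`c > 0` and `n₀` such that for all even `n ≥ n₀`: every exact SDP formulation of `PM_n` (Braun et al.
Def. 2.2, any size `d`) whose solution matrices are block diagonal with `m` blocks of size `≤ b ≤ n` has
`2^{c·n/(b+1)} ≤ m·n⁹` — with polynomially many blocks some block has dimension `Ω(n/log n)`.
[cite: BraunEtAl2016, Def. 2.2, Lemma 2.3] [cite: Rothvoss2017, Thm. 1] -/
theorem blockDiagonalSDP_largeBlocks : ∃ c : ℝ, 0 < c ∧ ∃ n₀ : ℕ, ∀ n : ℕ, n₀ ≤ n →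
    Even n → ∀ d m b : ℕ, 1 ≤ b → b ≤ n → ∀ (E : SDPFormulation (pmProblem n 0) d) (blk : Fin d → Fin m),
      (∀ (M : PMSol n) (p q : Fin d), blk p ≠ blk q → E.X M p q = 0) →
      (∀ i : Fin m, (univ.filter fun p : Fin d => blk p = i).card ≤ b) →
      (2 : ℝ) ^ (c * n / (b + 1)) ≤ m * (n : ℝ) ^ 9 := by
  obtain ⟨c, hc, n₀, hn₀⟩ := blockPsd_largeBlocks
  exact ⟨c, hc, n₀, fun n hn heven d m b hb hbn E blk hX hsize =>
    hn₀ n hn heven b m hb hbn (hasBlockPsdFactorization_of_blockDiagonalSDP E blk hX hsize)⟩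

end Summit.PneNP.PneNP.Theorems.SmallBlockRothvossBallGrid

end
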